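import Literature.MathematicalPhysics.QuantumFieldTheory.Balaban1983to89.B9Eq3105AtLetters

/-!
# `Balaban1983to89.B9Eq3105TAtLetters` — T. Bałaban, *Propagators for lattice gauge theories in a background field*, Commun. Math. Phys. **99** (1985)
# 389–434 [Balaban1985BackgroundPropagators], (3.105) p. 414 TRANSPOSED — «G₀Δ_a = I − R♯» AT def-Y's GENUINE LETTERS: the right-handed companion of
# `B9Eq3105AtLetters` (the `eq3105T` identity of `B9Thm310Whole.Identities310` at the cube cover of record; sub-row G-B9-LETTERS, module M5.7 «(3.105) assembly»)

statement-level skeleton of published theorems with citation tags; proofs where landed; nothing here is a claim about the Yang–Mills mass gap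

PDF held: `paper:balaban1985-cmp99-background-propagators` (journal page = PDF page + 388); pp. 409, 414 read from the held text layer.
p. 414 (3.105): «Δ_aG₀ = I − Σ_□K(h_□)G_□h_□ − Σ_□(1 − ζ_□̃)DPD*h_□G_□h_□ − Σ_□ζ_□̃(DPD* − DP_□D*)h_□G_□h_□ − Σ_□ζ_□̃P_{□,1}(∂h_□)G_□h_□ = I − R»; (3.104) p. 414
«Δ_a hA = hΔ_a − K(h)A − P₁(∂h)A»; (3.101) p. 414; (3.87) p. 409 «G₀ = Σ_{□∈𝒟} h_□G_□h_□»; p. 408 «We have Σ_□ h_□² = 1».  Print displays only the left identity;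
the Theorem 3.10 glue (`B9Thm310Whole.Identities310.eq3105T`, used for the right entry `G∇*_U` of (3.42)) needs the RIGHT one, `G₀Δ_a = I − R♯` («in print Δ_a and G₀
are symmetric, so R♯ = Rᵀ» — there); here it is DERIVED, as an exact identity, from the same displayed relations read from the other side.

WHAT THIS FILE PROVES (all `theorem`s, 0 `def … : Prop`, 0 sorry).
* §1 `eq3105T_sum` — the abstract ring identity (the right-handed twin of b09's `B9Eq3105Sum.eq3105_sum`): from (3.104) `ΛH = HΛ − K`, (3.101) `P_lH = HP_l + P₁`,
  `Hζ = H`, the RIGHT local-inverse relation `H·G_l·(Λ − P_l)·H = H·H` and `Σ H² = 1`: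
  `(Σ_□ H_□G_□H_□)(Λ − P_g) = 1 + Σ_□ H_□G_□K_□ + Σ_□ H_□G_□P_{1,□} − Σ_□ H_□G_□H_□·ζ_□(P_g − P_{l,□}) − Σ_□ H_□G_□H_□·(1 − ζ_□)P_g`
  (the commutator families change sign under transposition: `K(h) = hΔ_loc − Δ_loc h`, `P₁ = P_lh − hP_l`); `hlocT_of_localInverse` (the relation from a LEFT
  inverse `G_l(Λ_l − P_l) = 1` and the COLUMN agreement `ΛH = Λ_lH`).
* §2 at `Δ_a(U)`: ★ `eq3105T_deltaAY` (any partition family, any `ζ = 1 on supp h`, any `Gl`, `Pl`, displayed `hlocT`) and ★★ `eq3105T_hT_GACubeY` (partition of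
  record, r05's `G_□(U) = Δ_{a,□}(U)⁻¹`, `DP_□D*`, `P_{□,1}`; `hlocT` DISCHARGED from `IsUnit (Δ_{a,□}(U))` and a displayed COLUMN-agreement hypothesis
  `hcol` — the averaging columns of `Δ_{a,□}(U)`, `Δ_a(U)` agree on inputs supported in `supp h_□`; the column twin of r05's `QsaQCubeY_apply_eq_of_hT`, not in
  tree), + the LEFT fixed point `G = G₀ + R♯·G` for any RIGHT inverse `G` of `Δ_a(U)` (`fixedPoint3105T_hT_GACubeY`).
HONEST SCOPE.  Pure algebra; print does not display the transposed identity (bookkeeping for the glue); invertibility and column agreement are HYPOTHESES; no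
estimate; nothing continuum ∕ OS ∕ mass gap ∕ Clay; YM mass gap NOT proved by any of this (Track A conditional rung).  `--supports stmt-QuantumFields-19200`.
Net new unproved facts: 0.
-/

noncomputable section

namespace Literature.MathematicalPhysics.QuantumFieldTheory.Balaban1983to89.B9Eq3105TAtLetters

open Node00
open B9Thm37CubeCoverCommutators (cutMulY cutMulY_apply hTY hTY_apply sum_hTY_sq sum_cutMulY_mul_self)
open B9Eq3104CutoffCommutators (cutCommR comp_cutMulY_eq_sub hBdY hBdY_apply deltaLocY DPDsY KhBY deltaAY_eq_loc_sub)
open B9CubeLettersBondOpsL0 (QCubeY QsCubeY aCubeY deltaACubeY GACubeY GACubeY_mul_deltaACubeY)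
open B9Eq3105AtLetters (DPDsCubeY P1CubeY deltaLocCubeY deltaACubeY_eq_loc_sub DPDsCubeY_mul_cutMulY deltaLocY_mul_cutMulY)
open B6KLevelCensusIndexV1 (KIdx)
open B6Cover236MultiLevelBlocks (cubes)
open Node00.OpsYNablaBridge (chartY)
open scoped Matrix

/-! ## §1 The abstract right-handed (3.105) -/

section Abstract

variable {A : Type*} [Ring A] {κ : Type} [Fintype κ]

/-- the RIGHT local-inverse relation from its two ingredients: a LEFT inverse `G_l(Λ_l − P_l) = 1` of the local operator and the COLUMN agreement `ΛH = Λ_lH`.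
[cite: Balaban1985BackgroundPropagators, (3.87) p.409, p.409 l.3–5, bookkeeping] -/
theorem hlocT_of_localInverse {Λ Hm Λl Ploc Gl : A} (hinv : Gl * (Λl - Ploc) = 1) (hΛ : Λ * Hm = Λl * Hm) :
    Hm * Gl * (Λ - Ploc) * Hm = Hm * Hm := by
  rw [mul_assoc (Hm * Gl), sub_mul, hΛ, ← sub_mul, ← mul_assoc, mul_assoc Hm Gl, hinv, mul_one]

/-- ★ **(3.105) TRANSPOSED, in any ring**: data per cube as in `B9Eq3105Sum.eq3105_sum`; hypotheses (3.104) `h104`, (3.101) `h101`, `Hζ = H` (`hζ`), the RIGHT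
local-inverse relation (`hloc`) and `Σ H² = 1` (`hpu`).  Conclusion:
`(Σ_□ H_□G_□H_□)(Λ − P_g) = 1 + Σ_□ H_□G_□K_□ + Σ_□ H_□G_□P_{1,□} − Σ_□ H_□G_□H_□(ζ_□(P_g − P_{l,□})) − Σ_□ H_□G_□H_□((1 − ζ_□)P_g)`.
[cite: Balaban1985BackgroundPropagators, (3.105) p.414 (transposed), (3.104) p.414, (3.101) p.414] -/
theorem eq3105T_sum (Λ Pg : A) (Hm Z Gl Kh Ploc P1 : κ → A) (h104 : ∀ c, Λ * Hm c = Hm c * Λ - Kh c)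
    (h101 : ∀ c, Ploc c * Hm c = Hm c * Ploc c + P1 c) (hζ : ∀ c, Hm c * Z c = Hm c)
    (hloc : ∀ c, Hm c * Gl c * (Λ - Ploc c) * Hm c = Hm c * Hm c) (hpu : ∑ c, Hm c * Hm c = 1) :
    (∑ c, Hm c * Gl c * Hm c) * (Λ - Pg) =
      1 + ∑ c, Hm c * Gl c * Kh c + ∑ c, Hm c * Gl c * P1 c
        - ∑ c, Hm c * Gl c * Hm c * (Z c * (Pg - Ploc c))
        - ∑ c, Hm c * Gl c * Hm c * ((1 - Z c) * Pg) := by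
  have hΛ' : ∀ c, Hm c * Λ = Λ * Hm c + Kh c := fun c => by rw [h104 c, sub_add_cancel]
  have hP' : ∀ c, Hm c * Ploc c = Ploc c * Hm c - P1 c := fun c => by rw [h101 c, add_sub_cancel_right]
  have hterm : ∀ c, Hm c * Gl c * Hm c * (Λ - Pg) = Hm c * Hm c + (Hm c * Gl c * Kh c + Hm c * Gl c * P1 c
      - Hm c * Gl c * Hm c * (Z c * (Pg - Ploc c)) - Hm c * Gl c * Hm c * ((1 - Z c) * Pg)) := by
    intro c
    have e1 : Hm c * Gl c * Hm c * (Λ - Pg) = Hm c * Gl c * (Hm c * Λ) - Hm c * Gl c * Hm c * (Z c * (Pg - Ploc c))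
        - Hm c * Gl c * Hm c * ((1 - Z c) * Pg) - Hm c * Gl c * ((Hm c * Z c) * Ploc c) := by noncomm_ring
    rw [hΛ' c, hζ c, hP' c] at e1
    rw [e1, ← hloc c]
    noncomm_ring
  rw [Finset.sum_mul, Finset.sum_congr rfl fun c _ => hterm c, Finset.sum_add_distrib, hpu, Finset.sum_sub_distrib, Finset.sum_sub_distrib,
    Finset.sum_add_distrib]
  abel

end Abstract

variable {d ℓ : ℕ} {hd : 1 ≤ d + 1} {hL : Odd (ℓ + 1) ∧ 1 < ℓ + 1} {b₀ b₁ : ℝ}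
variable {𝔸 : Type} [NormedRing 𝔸] [NormedAlgebra ℂ 𝔸] [CompleteSpace 𝔸]
variable (i : KIdx d ℓ hd hL b₀ b₁)

/-! ## §2 At `Δ_a(U)`: generic partition family, then the partition of record with r05's cube letters -/

section Generic

omit [CompleteSpace 𝔸] in
/-- `h·ζ = h` as operators when `ζ = 1` wherever `h ≠ 0` (the right-handed form of «ζ_□̃h_□ = h_□»). [cite: Balaban1985BackgroundPropagators, p.415, bookkeeping] -/
theorem cutMulY_mul_cutMulY_of_eq_one' {X : Type} (h ζ : X → ℝ) (hζ : ∀ x, h x ≠ 0 → ζ x = 1) :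
    cutMulY (𝔸 := 𝔸) h * cutMulY ζ = cutMulY h := by
  refine LinearMap.ext fun Λ => funext fun x => ?_
  simp only [Module.End.mul_apply, cutMulY_apply, smul_smul, ← Complex.ofReal_mul]
  by_cases hx : h x = 0
  · rw [hx, zero_mul]
  · rw [hζ x hx, mul_one]

/-- ★ **(3.105) TRANSPOSED AT `Δ_a(U)`, GENERIC FORM**: for ANY real family `hf` with `Σ hf² = 1`, ANY cut-offs `ζ = 1 on supp hf`, ANY cube operators `Gl` and local
projection letters `Pl` with the RIGHT local-inverse relation `h·Gl·(Δ_loc − Pl)·h = h·h` (displayed):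
`(Σ_□ h_□Gl_□h_□)·Δ_a(U) = 1 + Σ_□ h_□Gl_□K(h_□)(U) + Σ_□ h_□Gl_□P_{l,1}(∂h_□) − Σ_□ h_□Gl_□h_□·ζ_□(DPD*(U) − Pl_□) − Σ_□ h_□Gl_□h_□·(1 − ζ_□)DPD*(U)`.
[cite: Balaban1985BackgroundPropagators, (3.105) p.414 (transposed), (3.104) p.414, (3.101) p.414, (3.87) p.409, p.408 («Σ h_□² = 1»)] -/
theorem eq3105T_deltaAY (parS : SiteParY 𝔸 i) (parB : BondParY 𝔸 i) (Gp : SiteOpY 𝔸 i) (U : CfgY 𝔸 i) {κ : Type} [Fintype κ]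
    (hf : κ → SiteY i → ℝ) (hsq : ∀ z, ∑ c, hf c z ^ 2 = 1) (ζ : κ → SiteY i → ℝ) (hζ : ∀ c z, hf c z ≠ 0 → ζ c z = 1)
    (Gl Pl : κ → Module.End ℂ (FBondY i → 𝔸))
    (hlocT : ∀ c, cutMulY (hBdY i (hf c)) * Gl c * (deltaLocY i parB U - Pl c) * cutMulY (hBdY i (hf c)) =
      cutMulY (hBdY i (hf c)) * cutMulY (hBdY i (hf c))) :
    (∑ c, cutMulY (hBdY i (hf c)) * Gl c * cutMulY (hBdY i (hf c))) * deltaAY i parS parB Gp U =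
      1 + ∑ c, cutMulY (hBdY i (hf c)) * Gl c * KhBY i (hf c) parB U
        + ∑ c, cutMulY (hBdY i (hf c)) * Gl c * -cutCommR (hBdY i (hf c)) (hBdY i (hf c)) (Pl c)
        - ∑ c, cutMulY (hBdY i (hf c)) * Gl c * cutMulY (hBdY i (hf c)) * (cutMulY (hBdY i (ζ c)) * (DPDsY i parS Gp U - Pl c))
        - ∑ c, cutMulY (hBdY i (hf c)) * Gl c * cutMulY (hBdY i (hf c)) * ((1 - cutMulY (hBdY i (ζ c))) * DPDsY i parS Gp U) := by
  rw [deltaAY_eq_loc_sub]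
  refine eq3105T_sum (deltaLocY i parB U) (DPDsY i parS Gp U) (fun c => cutMulY (hBdY i (hf c))) (fun c => cutMulY (hBdY i (ζ c)))
    Gl (fun c => KhBY i (hf c) parB U) Pl (fun c => -cutCommR (hBdY i (hf c)) (hBdY i (hf c)) (Pl c))
    (fun c => deltaLocY_mul_cutMulY i (hf c) parB U) (fun c => ?_) (fun c => ?_) hlocT ?_
  · rw [← sub_eq_add_neg]
    exact comp_cutMulY_eq_sub (hBdY i (hf c)) (hBdY i (hf c)) (Pl c)
  · exact cutMulY_mul_cutMulY_of_eq_one' (hBdY i (hf c)) (hBdY i (ζ c)) fun b hb => hζ c (chartY i b.src) hb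
  · exact sum_cutMulY_mul_self (fun c => hBdY i (hf c)) fun b => hsq (chartY i b.src)

end Generic

section Record

/-- the RIGHT local-inverse relation DISCHARGED: `Δ_{a,□}(U)` invertible and the averaging COLUMNS of `Δ_{a,□}(U)`, `Δ_a(U)` agreeing on inputs cut off by `h` give
`h·G_□(U)·(Δ_loc(U) − DP_□D*(U))·h = h·h`. [cite: Balaban1985BackgroundPropagators, (3.87) p.409, p.409 l.3–5, (3.105) p.414] -/
theorem hlocT_GACubeY (q : ↥(cubes i.D.toDomains)) (parS : SiteParY 𝔸 i) (parB : BondParY 𝔸 i) (U : CfgY 𝔸 i) (h : SiteY i → ℝ)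
    (hinv : IsUnit (deltaACubeY i q parS parB U))
    (hcol : ∀ (A : FBondY i → 𝔸) (f : FBondY i),
      QsCubeY i q parB U (aCubeY i q (QCubeY i q parB U (cutMulY (hBdY i h) A))) f = QsY i parB U (aY i (QY i parB U (cutMulY (hBdY i h) A))) f) :
    cutMulY (hBdY i h) * GACubeY i q parS parB U * (deltaLocY i parB U - DPDsCubeY i q parS U) * cutMulY (hBdY i h) =
      cutMulY (hBdY i h) * cutMulY (hBdY i h) := by
  refine hlocT_of_localInverse (Λl := deltaLocCubeY i q parB U) ?_ ?_
  · rw [← deltaACubeY_eq_loc_sub]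
    exact GACubeY_mul_deltaACubeY i q hinv
  · refine LinearMap.ext fun A => funext fun f => ?_
    rw [Module.End.mul_apply, Module.End.mul_apply]
    simp only [deltaLocY, deltaLocCubeY, LinearMap.add_apply, Pi.add_apply, LinearMap.comp_apply]
    rw [hcol A f]

/-- ★★ **(3.105) TRANSPOSED AT THE PARTITION OF RECORD AND THE CUBE LETTERS**: with `h_□ = hTY i □`, `G_□(U) = GACubeY i □ parS parB U`, `DP_□D*(U) = DPDsCubeY i □ parS U`,
`P_{□,1}(∂h_□)(U) = P1CubeY i □ (hTY i □) parS U`, ANY cut-offs `ζ_□̃ = 1` on `supp h_□`, every `Δ_{a,□}(U)` invertible and the averaging columns agreeing on inputs cut off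
by `h_□`: `(Σ_□ h_□G_□(U)h_□)·Δ_a(U) = 1 + Σ_□ h_□G_□(U)K(h_□)(U) + Σ_□ h_□G_□(U)P_{□,1}(∂h_□)(U) − Σ_□ (h_□G_□(U)h_□)·ζ_□̃(DPD*(U) − DP_□D*(U)) − Σ_□ (h_□G_□(U)h_□)·(1 − ζ_□̃)DPD*(U)`
— the `eq3105T` identity `G₀Δ_a = I − R♯` with `R♯` explicit. [cite: Balaban1985BackgroundPropagators, (3.105) p.414 (transposed), (3.87) p.409, p.408 («Σ h_□² = 1»), p.409 l.3–5] -/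
theorem eq3105T_hT_GACubeY (parS : SiteParY 𝔸 i) (parB : BondParY 𝔸 i) (Gp : SiteOpY 𝔸 i) (U : CfgY 𝔸 i)
    (ζ : ↥(cubes i.D.toDomains) → SiteY i → ℝ) (hζ : ∀ c z, hTY i c z ≠ 0 → ζ c z = 1)
    (hinv : ∀ c : ↥(cubes i.D.toDomains), IsUnit (deltaACubeY i c parS parB U))
    (hcol : ∀ (c : ↥(cubes i.D.toDomains)) (A : FBondY i → 𝔸) (f : FBondY i),
      QsCubeY i c parB U (aCubeY i c (QCubeY i c parB U (cutMulY (hBdY i (hTY i c)) A))) f =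
        QsY i parB U (aY i (QY i parB U (cutMulY (hBdY i (hTY i c)) A))) f) :
    (∑ c, cutMulY (hBdY i (hTY i c)) * GACubeY i c parS parB U * cutMulY (hBdY i (hTY i c))) * deltaAY i parS parB Gp U =
      1 + ∑ c, cutMulY (hBdY i (hTY i c)) * GACubeY i c parS parB U * KhBY i (hTY i c) parB U
        + ∑ c, cutMulY (hBdY i (hTY i c)) * GACubeY i c parS parB U * P1CubeY i c (hTY i c) parS U
        - ∑ c, cutMulY (hBdY i (hTY i c)) * GACubeY i c parS parB U * cutMulY (hBdY i (hTY i c)) *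
            (cutMulY (hBdY i (ζ c)) * (DPDsY i parS Gp U - DPDsCubeY i c parS U))
        - ∑ c, cutMulY (hBdY i (hTY i c)) * GACubeY i c parS parB U * cutMulY (hBdY i (hTY i c)) *
            ((1 - cutMulY (hBdY i (ζ c))) * DPDsY i parS Gp U) :=
  eq3105T_deltaAY i parS parB Gp U (hTY i) (sum_hTY_sq i) ζ hζ (fun c => GACubeY i c parS parB U) (fun c => DPDsCubeY i c parS U)
    fun c => hlocT_GACubeY i c parS parB U (hTY i c) (hinv c) (hcol c)

/-- ★ the LEFT fixed point `G = G₀ + R♯·G` for ANY right inverse `G` of `Δ_a(U)` (`Δ_a(U)·G = 1`), `R♯` the four transposed sums — the shape the glue's right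
entry `G∇*_U` consumes. [cite: Balaban1985BackgroundPropagators, (3.105)–(3.106) p.414 (transposed), (3.87) p.409] -/
theorem fixedPoint3105T_hT_GACubeY (parS : SiteParY 𝔸 i) (parB : BondParY 𝔸 i) (Gp : SiteOpY 𝔸 i) (U : CfgY 𝔸 i)
    (ζ : ↥(cubes i.D.toDomains) → SiteY i → ℝ) (hζ : ∀ c z, hTY i c z ≠ 0 → ζ c z = 1)
    (hinv : ∀ c : ↥(cubes i.D.toDomains), IsUnit (deltaACubeY i c parS parB U))
    (hcol : ∀ (c : ↥(cubes i.D.toDomains)) (A : FBondY i → 𝔸) (f : FBondY i),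
      QsCubeY i c parB U (aCubeY i c (QCubeY i c parB U (cutMulY (hBdY i (hTY i c)) A))) f =
        QsY i parB U (aY i (QY i parB U (cutMulY (hBdY i (hTY i c)) A))) f)
    {G : Module.End ℂ (FBondY i → 𝔸)} (hG : deltaAY i parS parB Gp U * G = 1) :
    G = (∑ c, cutMulY (hBdY i (hTY i c)) * GACubeY i c parS parB U * cutMulY (hBdY i (hTY i c)))
      + (-(∑ c, cutMulY (hBdY i (hTY i c)) * GACubeY i c parS parB U * KhBY i (hTY i c) parB U)
          - ∑ c, cutMulY (hBdY i (hTY i c)) * GACubeY i c parS parB U * P1CubeY i c (hTY i c) parS U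
          + ∑ c, cutMulY (hBdY i (hTY i c)) * GACubeY i c parS parB U * cutMulY (hBdY i (hTY i c)) *
              (cutMulY (hBdY i (ζ c)) * (DPDsY i parS Gp U - DPDsCubeY i c parS U))
          + ∑ c, cutMulY (hBdY i (hTY i c)) * GACubeY i c parS parB U * cutMulY (hBdY i (hTY i c)) *
              ((1 - cutMulY (hBdY i (ζ c))) * DPDsY i parS Gp U)) * G := by
  set G0 := ∑ c, cutMulY (hBdY i (hTY i c)) * GACubeY i c parS parB U * cutMulY (hBdY i (hTY i c)) with hG0
  set V := -(∑ c, cutMulY (hBdY i (hTY i c)) * GACubeY i c parS parB U * KhBY i (hTY i c) parB U)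
      - ∑ c, cutMulY (hBdY i (hTY i c)) * GACubeY i c parS parB U * P1CubeY i c (hTY i c) parS U
      + ∑ c, cutMulY (hBdY i (hTY i c)) * GACubeY i c parS parB U * cutMulY (hBdY i (hTY i c)) *
          (cutMulY (hBdY i (ζ c)) * (DPDsY i parS Gp U - DPDsCubeY i c parS U))
      + ∑ c, cutMulY (hBdY i (hTY i c)) * GACubeY i c parS parB U * cutMulY (hBdY i (hTY i c)) *
          ((1 - cutMulY (hBdY i (ζ c))) * DPDsY i parS Gp U) with hV
  have h105T : G0 * deltaAY i parS parB Gp U = 1 - V := by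
    rw [hG0, eq3105T_hT_GACubeY i parS parB Gp U ζ hζ hinv hcol, hV]
    abel
  have h1 : G0 * deltaAY i parS parB Gp U * G = (1 - V) * G := by rw [h105T]
  rw [mul_assoc, hG, mul_one, sub_mul, one_mul] at h1
  rw [h1, sub_add_cancel]

end Record

end Literature.MathematicalPhysics.QuantumFieldTheory.Balaban1983to89.B9Eq3105TAtLetters

end
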